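import Mathlib
import Summits.KontsevichZagierPeriods.Zeta5Search.GHatThirdOrder
import HarnessLib

/-!
# ζ(5) search — `p`-adic Taylor expansion of integer powers and finite products TO FOURTH ORDER (tools for the fourth digit (W4)/(V4))

Cell `pub-zeta5` (HONEST FRAMING: systematic search; no irrationality claim unless certified), gen-2 seat generation 14
(REPORT-gen2-g14 §1 (G4): `Ĝ_x(η) ≡ 1 − pφη + p²cη² − p³c₃η³ (mod p⁴)`, `c = (φ² − φ₂)/2`, `c₃ = φ³/6 − φφ₂/2 + φ₃/3`).
Generic `p`-adic estimates (rational numbers, `padicNorm`), one order beyond `PadicThirdOrder.lean`, for a prime `p ≥ 5`: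
* `padicNorm_zpow_add_sub_le₄` — `(u + t)^e ≡ u^e (1 + e·x + e(e−1)/2·x² + e(e−1)(e−2)/6·x³) (mod p⁴)`, `x = t/u`, for a unit `u`,
  `‖t‖ ≤ p⁻¹`, ALL `e ∈ ℤ` (two-sided induction through the exact step identity `D(e+1) = (u+t)D(e) + u^{e+1}·e(e−1)(e−2)/6·x⁴`);
* `padicNorm_prod_zpow_add_sub_le₄` — product form: `∏ (u_i + t)^{e_i} ≡ (∏ u_i^{e_i})(1 + t s₁ + t²(s₁² − s₂)/2 + t³(s₁³ − 3s₁s₂ + 2s₃)/6) (mod p⁴)`,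
  `s_k = Σ e_i/u_i^k`;
* `padicNorm_gHat_sub_fourth_le` — the class unit to fourth order: `ĝ_q ≡ ĝ_x (1 − ℓpφ_x + ℓ²p²c_x − ℓ³p³c₃,x) (mod p⁴)` for `x < p`,
  `q = x + ℓp` in the class of `x`, with `c₃,x = (φ_x³ − 3φ_xφ₂,x + 2φ₃,x)/6` written out (`φ₃,x` = the explicit foreign sum of inverse
  cubes + the odd-centre term; this is `cubicHat` of the staged `SecondResidueLaw.lean`, kept explicit so that this file does not depend on it)
  — one order beyond `padicNorm_gHat_sub_third_le`.
Nothing here concerns irrationality.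
-/

noncomputable section

open Finset

namespace Summit.KontsevichZagierPeriods.Zeta5Search.SecondOrder

open Summit.KontsevichZagierPeriods.Zeta5Search.PadicSeries
open Summit.KontsevichZagierPeriods.Zeta5Search.ClusterValuation
open Summit.KontsevichZagierPeriods.Zeta5Search.CellA (padicNorm_sub_eq_one_of_mod_ne padicNorm_zpow_unit padicNorm_pow_eq padicNorm_inv'
  padicNorm_prod_le_one padicNorm_p)

variable {p : ℕ} [hp : Fact p.Prime]

/-! ### Small `p`-adic tools -/

/-- `‖t^4‖ ≤ p^{-4}` when `‖t‖ ≤ p⁻¹`. -/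
theorem padicNorm_pow_four_le {t : ℚ} (ht : padicNorm p t ≤ (p : ℚ) ^ (-(1 : ℤ))) : padicNorm p (t ^ 4) ≤ (p : ℚ) ^ (-(4 : ℤ)) := by
  rw [padicNorm_pow_eq]
  calc padicNorm p t ^ 4 ≤ ((p : ℚ) ^ (-(1 : ℤ))) ^ 4 := pow_le_pow_left₀ (padicNorm.nonneg _) ht 4
    _ = (p : ℚ) ^ (-(4 : ℤ)) := by rw [← zpow_natCast, ← zpow_mul]; norm_num

/-- `‖a · b · t⁴‖ ≤ p⁻⁴` for `p`-integral `a, b` and `‖t‖ ≤ p⁻¹`. -/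
theorem padicNorm_mul_mul_pow_four_le {a b t : ℚ} (ha : padicNorm p a ≤ 1) (hb : padicNorm p b ≤ 1)
    (ht : padicNorm p t ≤ (p : ℚ) ^ (-(1 : ℤ))) : padicNorm p (a * b * t ^ 4) ≤ (p : ℚ) ^ (-(4 : ℤ)) := by
  rw [padicNorm.mul, padicNorm.mul]
  calc padicNorm p a * padicNorm p b * padicNorm p (t ^ 4) ≤ 1 * 1 * (p : ℚ) ^ (-(4 : ℤ)) :=
        mul_le_mul (mul_le_mul ha hb (padicNorm.nonneg _) zero_le_one) (padicNorm_pow_four_le ht) (padicNorm.nonneg _)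
          (by positivity)
    _ = _ := by ring

/-- `6` is a `p`-adic unit for `p ≥ 5`. -/
theorem padicNorm_six (hp5 : 5 ≤ p) : padicNorm p (6 : ℚ) = 1 := by
  have h : ¬ p ∣ 6 := by
    intro h
    rcases (Nat.Prime.dvd_mul hp.out).1 (show p ∣ 2 * 3 from h) with h2 | h3
    · have := Nat.le_of_dvd (by norm_num) h2; omega
    · have := Nat.le_of_dvd (by norm_num) h3; omega
  exact_mod_cast (padicNorm.nat_eq_one_iff (p := p) 6).2 h

/-- `‖e(e−1)(e−2)/6‖ ≤ 1` for `e ∈ ℤ` and `p ≥ 5`. -/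
theorem padicNorm_binom3_le (hp5 : 5 ≤ p) (e : ℤ) : padicNorm p ((e : ℚ) * (e - 1) * (e - 2) / 6) ≤ 1 := by
  rw [padicNorm.div, padicNorm_six hp5, div_one, padicNorm.mul, padicNorm.mul]
  have h1 : padicNorm p ((e : ℚ) - 1) ≤ 1 := by
    have : ((e : ℚ) - 1) = (((e - 1 : ℤ)) : ℚ) := by push_cast; ring
    rw [this]; exact padicNorm.of_int _
  have h2 : padicNorm p ((e : ℚ) - 2) ≤ 1 := by
    have : ((e : ℚ) - 2) = (((e - 2 : ℤ)) : ℚ) := by push_cast; ring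
    rw [this]; exact padicNorm.of_int _
  calc padicNorm p (e : ℚ) * padicNorm p ((e : ℚ) - 1) * padicNorm p ((e : ℚ) - 2) ≤ 1 * 1 * 1 :=
        mul_le_mul (mul_le_mul (padicNorm.of_int _) h1 (padicNorm.nonneg _) zero_le_one) h2 (padicNorm.nonneg _) (by positivity)
    _ = 1 := by ring

/-- `‖e(e−1)/2‖ ≤ 1` for `e ∈ ℤ` and `p` odd. -/
theorem padicNorm_binom2_le (hp2 : p ≠ 2) (e : ℤ) : padicNorm p ((e : ℚ) * (e - 1) / 2) ≤ 1 := by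
  rw [padicNorm.div, padicNorm_two (p := p) hp2, div_one, padicNorm.mul]
  have h1 : padicNorm p ((e : ℚ) - 1) ≤ 1 := by
    have : ((e : ℚ) - 1) = (((e - 1 : ℤ)) : ℚ) := by push_cast; ring
    rw [this]; exact padicNorm.of_int _
  calc padicNorm p (e : ℚ) * padicNorm p ((e : ℚ) - 1) ≤ 1 * 1 :=
        mul_le_mul (padicNorm.of_int _) h1 (padicNorm.nonneg _) zero_le_one
    _ = 1 := one_mul 1

/-! ### Integer powers to fourth order -/

/-- **Integer powers to fourth order** for a unit `u` and `‖t‖ ≤ p⁻¹` (`p ≥ 5`). -/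
theorem padicNorm_zpow_add_sub_le₄ (hp5 : 5 ≤ p) {u t : ℚ} (hu : padicNorm p u = 1) (ht : padicNorm p t ≤ (p : ℚ) ^ (-(1 : ℤ)))
    (e : ℤ) :
    padicNorm p ((u + t) ^ e - u ^ e * (1 + (e : ℚ) * (t / u) + (e : ℚ) * (e - 1) / 2 * (t / u) ^ 2
      + (e : ℚ) * (e - 1) * (e - 2) / 6 * (t / u) ^ 3)) ≤ (p : ℚ) ^ (-(4 : ℤ)) := by
  have hp2 : p ≠ 2 := by omega
  have hu0 : u ≠ 0 := fun h => by rw [h, padicNorm.zero] at hu; exact zero_ne_one hu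
  have hut1 : padicNorm p (u + t) = 1 := padicNorm_add_small_eq_one hu ht
  have hut0 : u + t ≠ 0 := fun h => by rw [h, padicNorm.zero] at hut1; exact zero_ne_one hut1
  have htu : padicNorm p (t / u) ≤ (p : ℚ) ^ (-(1 : ℤ)) := by rw [padicNorm.div, hu, div_one]; exact ht
  -- the inhomogeneity of the step identity is `O(p⁴)` for every `e`
  have hinh : ∀ e : ℤ, padicNorm p (u ^ (e + 1) * ((e : ℚ) * (e - 1) * (e - 2) / 6) * (t / u) ^ 4) ≤ (p : ℚ) ^ (-(4 : ℤ)) :=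
    fun e => padicNorm_mul_mul_pow_four_le (padicNorm_zpow_unit hu _).le (padicNorm_binom3_le hp5 e) htu
  -- the third-order Taylor defect and its exact step identity
  set D : ℤ → ℚ := fun e => (u + t) ^ e - u ^ e * (1 + (e : ℚ) * (t / u) + (e : ℚ) * (e - 1) / 2 * (t / u) ^ 2
      + (e : ℚ) * (e - 1) * (e - 2) / 6 * (t / u) ^ 3) with hD
  have hstep : ∀ e : ℤ, D (e + 1) = (u + t) * D e + u ^ (e + 1) * ((e : ℚ) * (e - 1) * (e - 2) / 6) * (t / u) ^ 4 := by
    intro e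
    simp only [hD]
    rw [zpow_add_one₀ hut0, zpow_add_one₀ hu0]
    push_cast
    field_simp
    ring
  change padicNorm p (D e) ≤ (p : ℚ) ^ (-(4 : ℤ))
  induction e using Int.induction_on with
  | zero =>
    have e0 : D 0 = 0 := by simp only [hD]; rw [zpow_zero, zpow_zero]; push_cast; ring
    rw [e0, padicNorm.zero]; exact zpow_p_nonneg _
  | succ n ih =>
    rw [hstep]
    refine (padicNorm.nonarchimedean (p := p)).trans (max_le ?_ (hinh _))
    rw [padicNorm.mul, hut1, one_mul]; exact ih
  | pred n ih =>
    have hstep' := hstep (-(n : ℤ) - 1)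
    rw [show (-(n : ℤ) - 1 + 1) = -(n : ℤ) by ring] at hstep'
    have e1 : D (-(n : ℤ) - 1) =
        (u + t)⁻¹ * (D (-(n : ℤ)) - u ^ (-(n : ℤ)) * ((((-(n : ℤ) - 1 : ℤ) : ℚ)) * (((-(n : ℤ) - 1 : ℤ) : ℚ) - 1)
          * (((-(n : ℤ) - 1 : ℤ) : ℚ) - 2) / 6) * (t / u) ^ 4) := by
      rw [hstep']; field_simp; ring
    rw [e1, padicNorm.mul, padicNorm_inv', hut1, inv_one, one_mul]
    refine (padicNorm.sub (p := p)).trans (max_le ih ?_)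
    have := hinh (-(n : ℤ) - 1)
    rw [show (-(n : ℤ) - 1 + 1) = -(n : ℤ) by ring] at this
    exact this

/-! ### Finite products to fourth order -/

/-- **`∏ (u_i + t)^{e_i} ≡ (∏ u_i^{e_i}) · (1 + t s₁ + t²(s₁² − s₂)/2 + t³(s₁³ − 3 s₁ s₂ + 2 s₃)/6) (mod p⁴)`**, `s_k = Σ e_i/u_i^k`,
for units `u_i` and `‖t‖ ≤ p⁻¹` (`p ≥ 5`). -/
theorem padicNorm_prod_zpow_add_sub_le₄ (hp5 : 5 ≤ p) {ι : Type*} (s : Finset ι) (u : ι → ℚ) (e : ι → ℤ) {t : ℚ}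
    (hu : ∀ i ∈ s, padicNorm p (u i) = 1) (ht : padicNorm p t ≤ (p : ℚ) ^ (-(1 : ℤ))) :
    padicNorm p (∏ i ∈ s, (u i + t) ^ e i - (∏ i ∈ s, u i ^ e i) *
      (1 + t * ∑ i ∈ s, (e i : ℚ) / u i
        + t ^ 2 * (((∑ i ∈ s, (e i : ℚ) / u i) ^ 2 - ∑ i ∈ s, (e i : ℚ) / u i ^ 2) / 2)
        + t ^ 3 * (((∑ i ∈ s, (e i : ℚ) / u i) ^ 3 - 3 * (∑ i ∈ s, (e i : ℚ) / u i) * (∑ i ∈ s, (e i : ℚ) / u i ^ 2)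
            + 2 * ∑ i ∈ s, (e i : ℚ) / u i ^ 3) / 6))) ≤ (p : ℚ) ^ (-(4 : ℤ)) := by
  classical
  have hp2 : p ≠ 2 := by omega
  have h2 := padicNorm_two (p := p) hp2
  have h6 := padicNorm_six (p := p) hp5
  have h3 : padicNorm p (3 : ℚ) ≤ 1 := by simpa using padicNorm.of_nat (p := p) 3
  have ht1 : padicNorm p t ≤ 1 := ht.trans (zpow_le_one_of_nonpos₀ one_le_p (by norm_num))
  induction s using Finset.induction_on with
  | empty =>
    have key : ∀ x : ℚ, x = 0 → padicNorm p x ≤ (p : ℚ) ^ (-(4 : ℤ)) := fun x hx => by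
      rw [hx, padicNorm.zero]; exact zpow_p_nonneg _
    apply key
    simp
  | insert a s ha ih =>
    have hua : padicNorm p (u a) = 1 := hu a (mem_insert_self a s)
    have hua0 : u a ≠ 0 := fun h => by rw [h, padicNorm.zero] at hua; exact zero_ne_one hua
    have hus : ∀ i ∈ s, padicNorm p (u i) = 1 := fun i hi => hu i (mem_insert_of_mem hi)
    have ih' := ih hus
    -- abbreviations
    set P := ∏ i ∈ s, u i ^ e i with hP
    set S₁ := ∑ i ∈ s, (e i : ℚ) / u i with hS₁
    set S₂ := ∑ i ∈ s, (e i : ℚ) / u i ^ 2 with hS₂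
    set S₃ := ∑ i ∈ s, (e i : ℚ) / u i ^ 3 with hS₃
    set α : ℚ := (e a : ℚ) / u a with hα
    set β : ℚ := (e a : ℚ) * (e a - 1) / 2 / u a ^ 2 with hβ
    set β₃ : ℚ := (e a : ℚ) * (e a - 1) * (e a - 2) / 6 / u a ^ 3 with hβ₃
    set γ : ℚ := (S₁ ^ 2 - S₂) / 2 with hγ
    set γ₃ : ℚ := (S₁ ^ 3 - 3 * S₁ * S₂ + 2 * S₃) / 6 with hγ₃
    -- norms of the pieces
    have hFa : padicNorm p ((u a + t) ^ e a) ≤ 1 := (padicNorm_zpow_unit (padicNorm_add_small_eq_one hua ht) _).le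
    have hPn : padicNorm p P ≤ 1 := padicNorm_prod_le_one s _ fun i hi => (padicNorm_zpow_unit (hus i hi) _).le
    have hS₁n : padicNorm p S₁ ≤ 1 := by
      refine padicNorm.sum_le' (fun i hi => ?_) zero_le_one
      rw [padicNorm.div, hus i hi, div_one]; exact padicNorm.of_int _
    have hS₂n : padicNorm p S₂ ≤ 1 := by
      refine padicNorm.sum_le' (fun i hi => ?_) zero_le_one
      rw [padicNorm.div, padicNorm_pow_eq, hus i hi, one_pow, div_one]; exact padicNorm.of_int _
    have hS₃n : padicNorm p S₃ ≤ 1 := by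
      refine padicNorm.sum_le' (fun i hi => ?_) zero_le_one
      rw [padicNorm.div, padicNorm_pow_eq, hus i hi, one_pow, div_one]; exact padicNorm.of_int _
    have hαn : padicNorm p α ≤ 1 := by rw [hα, padicNorm.div, hua, div_one]; exact padicNorm.of_int _
    have hβn : padicNorm p β ≤ 1 := by
      rw [hβ, padicNorm.div, padicNorm_pow_eq, hua, one_pow, div_one]; exact padicNorm_binom2_le hp2 _
    have hβ₃n : padicNorm p β₃ ≤ 1 := by
      rw [hβ₃, padicNorm.div, padicNorm_pow_eq, hua, one_pow, div_one]; exact padicNorm_binom3_le hp5 _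
    have hmul1 : ∀ {x y : ℚ}, padicNorm p x ≤ 1 → padicNorm p y ≤ 1 → padicNorm p (x * y) ≤ 1 := by
      intro x y hx hy
      rw [padicNorm.mul]
      calc padicNorm p x * padicNorm p y ≤ 1 * 1 := mul_le_mul hx hy (padicNorm.nonneg _) zero_le_one
        _ = 1 := one_mul 1
    have hadd1 : ∀ {x y : ℚ}, padicNorm p x ≤ 1 → padicNorm p y ≤ 1 → padicNorm p (x + y) ≤ 1 :=
      fun hx hy => (padicNorm.nonarchimedean (p := p)).trans (max_le hx hy)
    have hsub1 : ∀ {x y : ℚ}, padicNorm p x ≤ 1 → padicNorm p y ≤ 1 → padicNorm p (x - y) ≤ 1 :=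
      fun hx hy => (padicNorm.sub (p := p)).trans (max_le hx hy)
    have hpow1 : ∀ {x : ℚ} (n : ℕ), padicNorm p x ≤ 1 → padicNorm p (x ^ n) ≤ 1 := by
      intro x n hx; rw [padicNorm_pow_eq]; exact pow_le_one₀ (padicNorm.nonneg _) hx
    have hγn : padicNorm p γ ≤ 1 := by
      rw [hγ, padicNorm.div, h2, div_one]; exact hsub1 (hpow1 2 hS₁n) hS₂n
    have hγ₃n : padicNorm p γ₃ ≤ 1 := by
      rw [hγ₃, padicNorm.div, h6, div_one]
      refine hadd1 (hsub1 (hpow1 3 hS₁n) (hmul1 (hmul1 h3 hS₁n) hS₂n)) (hmul1 ?_ hS₃n)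
      simpa using padicNorm.of_nat (p := p) 2
    have hQ : padicNorm p (1 + t * S₁ + t ^ 2 * γ + t ^ 3 * γ₃) ≤ 1 :=
      hadd1 (hadd1 (hadd1 (by rw [padicNorm.one]) (hmul1 ht1 hS₁n)) (hmul1 (hpow1 2 ht1) hγn)) (hmul1 (hpow1 3 ht1) hγ₃n)
    have hδa := padicNorm_zpow_add_sub_le₄ hp5 hua ht (e a)
    -- the insertion identity
    rw [prod_insert ha, prod_insert ha, sum_insert ha, sum_insert ha, sum_insert ha]
    have eI : (u a + t) ^ e a * ∏ i ∈ s, (u i + t) ^ e i -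
        (u a ^ e a * P) * (1 + t * (α + S₁) + t ^ 2 * (((α + S₁) ^ 2 - ((e a : ℚ) / u a ^ 2 + S₂)) / 2)
          + t ^ 3 * (((α + S₁) ^ 3 - 3 * (α + S₁) * ((e a : ℚ) / u a ^ 2 + S₂) + 2 * ((e a : ℚ) / u a ^ 3 + S₃)) / 6)) =
        (u a + t) ^ e a * (∏ i ∈ s, (u i + t) ^ e i - P * (1 + t * S₁ + t ^ 2 * γ + t ^ 3 * γ₃))
        + ((u a + t) ^ e a - u a ^ e a * (1 + (e a : ℚ) * (t / u a) + (e a : ℚ) * (e a - 1) / 2 * (t / u a) ^ 2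
            + (e a : ℚ) * (e a - 1) * (e a - 2) / 6 * (t / u a) ^ 3))
            * (P * (1 + t * S₁ + t ^ 2 * γ + t ^ 3 * γ₃))
        + u a ^ e a * P * (α * γ₃ + β * γ + β₃ * S₁ + (β * γ₃ + β₃ * γ) * t + β₃ * γ₃ * t ^ 2) * t ^ 4 := by
      rw [hα, hβ, hβ₃, hγ, hγ₃]
      field_simp
      ring
    rw [eI]
    refine (padicNorm.nonarchimedean (p := p)).trans
      (max_le ((padicNorm.nonarchimedean (p := p)).trans (max_le ?_ ?_)) ?_)
    · rw [padicNorm.mul]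
      calc padicNorm p ((u a + t) ^ e a) * _ ≤ 1 * (p : ℚ) ^ (-(4 : ℤ)) :=
            mul_le_mul hFa ih' (padicNorm.nonneg _) zero_le_one
        _ = _ := one_mul _
    · rw [padicNorm.mul, padicNorm.mul]
      calc _ * (padicNorm p P * _) ≤ (p : ℚ) ^ (-(4 : ℤ)) * (1 * 1) :=
            mul_le_mul hδa (mul_le_mul hPn hQ (padicNorm.nonneg _) zero_le_one)
              (mul_nonneg (padicNorm.nonneg _) (padicNorm.nonneg _)) (zpow_p_nonneg _)
        _ = _ := by ring
    · have hU : padicNorm p (u a ^ e a * P) ≤ 1 := by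
        rw [padicNorm.mul, padicNorm_zpow_unit hua, one_mul]; exact hPn
      have hV : padicNorm p (α * γ₃ + β * γ + β₃ * S₁ + (β * γ₃ + β₃ * γ) * t + β₃ * γ₃ * t ^ 2) ≤ 1 :=
        hadd1 (hadd1 (hadd1 (hadd1 (hmul1 hαn hγ₃n) (hmul1 hβn hγn)) (hmul1 hβ₃n hS₁n))
          (hmul1 (hadd1 (hmul1 hβn hγ₃n) (hmul1 hβ₃n hγn)) ht1)) (hmul1 (hmul1 hβ₃n hγ₃n) (hpow1 2 ht1))
      exact padicNorm_mul_mul_pow_four_le hU hV ht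

/-! ### The class unit `ĝ` to fourth order -/

/-- `φ₃,x` written out: `Σ_{s ∉ class(x)} netExp(s)/(s − x)³` (+ the odd centre outside the class).  (Equals `phi3Hat b p x` of the staged
`SecondResidueLaw.lean`; an abbreviation local to this file's statements.) -/
def phi3Expl (b : ℕ → ℤ) (p x : ℕ) : ℚ :=
  (∑ s ∈ (range ((b 0).toNat + 1)).filter (fun s => s % p ≠ x % p), (netExp b s : ℚ) / ((s : ℚ) - x) ^ 3)
    + (if ¬ (2 : ℤ) ∣ b 0 ∧ ¬ CentreIn b p x then 1 / ((b 0 : ℚ) / 2 - x) ^ 3 else 0)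

/-- **`ĝ_q ≡ ĝ_x (1 − ℓpφ_x + ℓ²p²c_x − ℓ³p³c₃,x) (mod p⁴)`**, `c₃,x = (φ_x³ − 3φ_xφ₂,x + 2φ₃,x)/6`, for `x < p` and `q = x + ℓp` in the
class of `x` (`ℓ = q / p`), window `b₀ < p²`, `p ≥ 5`. -/
theorem padicNorm_gHat_sub_fourth_le (b : ℕ → ℤ) (hp5 : 5 ≤ p) {x q : ℕ} (hx : x < p) (hq : q ∈ classSet b p x) :
    padicNorm p (gHat b p q - gHat b p x *
      (1 - ((q / p : ℕ) : ℚ) * p * phiHat b p x + (((q / p : ℕ) : ℚ) * p) ^ 2 * curvHat b p x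
        - (((q / p : ℕ) : ℚ) * p) ^ 3 * ((phiHat b p x ^ 3 - 3 * phiHat b p x * phi2Hat b p x + 2 * phi3Expl b p x) / 6))) ≤
      (p : ℚ) ^ (-(4 : ℤ)) := by
  have hp2 : p ≠ 2 := by omega
  have hqx : q % p = x % p := (mem_filter.1 hq).2
  have htwo := padicNorm_two (p := p) hp2
  have hsix := padicNorm_six (p := p) hp5
  have h3 : padicNorm p (3 : ℚ) ≤ 1 := by simpa using padicNorm.of_nat (p := p) 3
  obtain ⟨hqdec, ht⟩ := class_point_decomp b hx hq
  set t : ℚ := -(((q / p : ℕ) : ℚ) * p) with htdef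
  have ht1 : padicNorm p t ≤ 1 := ht.trans (zpow_le_one_of_nonpos₀ one_le_p (by norm_num))
  -- the foreign set and the foreign products
  set S := (range ((b 0).toNat + 1)).filter (fun s => s % p ≠ x % p) with hS
  have hunit : ∀ s ∈ S, padicNorm p ((s : ℚ) - x) = 1 := fun s hs => padicNorm_sub_eq_one_of_mod_ne (mem_filter.1 hs).2
  have hsq : ∀ s ∈ S, ((s : ℚ) - q) = ((s : ℚ) - x) + t := by intro s _; rw [hqdec, htdef]; ring
  set A' := ∏ s ∈ S, ((s : ℚ) - q) ^ netExp b s with hA'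
  set A := ∏ s ∈ S, ((s : ℚ) - x) ^ netExp b s with hA
  set Q := ∑ s ∈ S, (netExp b s : ℚ) / ((s : ℚ) - x) with hQ
  set Q₂ := ∑ s ∈ S, (netExp b s : ℚ) / ((s : ℚ) - x) ^ 2 with hQ₂
  set Q₃ := ∑ s ∈ S, (netExp b s : ℚ) / ((s : ℚ) - x) ^ 3 with hQ₃
  set γ : ℚ := (Q ^ 2 - Q₂) / 2 with hγ
  set γ₃ : ℚ := (Q ^ 3 - 3 * Q * Q₂ + 2 * Q₃) / 6 with hγ₃
  have hAQ : padicNorm p (A' - A * (1 + t * Q + t ^ 2 * γ + t ^ 3 * γ₃)) ≤ (p : ℚ) ^ (-(4 : ℤ)) := by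
    have h := padicNorm_prod_zpow_add_sub_le₄ hp5 S (fun s => ((s : ℚ) - x)) (fun s => netExp b s) hunit ht
    rw [hA', prod_congr rfl fun s hs => by rw [hsq s hs]]
    exact h
  have hA1 : padicNorm p A ≤ 1 := padicNorm_prod_le_one S _ fun s hs => (padicNorm_zpow_unit (hunit s hs) _).le
  have hQ1 : padicNorm p Q ≤ 1 := by
    refine padicNorm.sum_le' (fun s hs => ?_) zero_le_one
    rw [padicNorm.div, hunit s hs, div_one]; exact padicNorm.of_int _
  have hQ₂1 : padicNorm p Q₂ ≤ 1 := by
    refine padicNorm.sum_le' (fun s hs => ?_) zero_le_one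
    rw [padicNorm.div, padicNorm_pow_eq, hunit s hs, one_pow, div_one]; exact padicNorm.of_int _
  have hQ₃1 : padicNorm p Q₃ ≤ 1 := by
    refine padicNorm.sum_le' (fun s hs => ?_) zero_le_one
    rw [padicNorm.div, padicNorm_pow_eq, hunit s hs, one_pow, div_one]; exact padicNorm.of_int _
  have hmul1 : ∀ {x y : ℚ}, padicNorm p x ≤ 1 → padicNorm p y ≤ 1 → padicNorm p (x * y) ≤ 1 := by
    intro x y hx hy
    rw [padicNorm.mul]
    calc padicNorm p x * padicNorm p y ≤ 1 * 1 := mul_le_mul hx hy (padicNorm.nonneg _) zero_le_one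
      _ = 1 := one_mul 1
  have hadd1 : ∀ {x y : ℚ}, padicNorm p x ≤ 1 → padicNorm p y ≤ 1 → padicNorm p (x + y) ≤ 1 :=
    fun hx hy => (padicNorm.nonarchimedean (p := p)).trans (max_le hx hy)
  have hsub1 : ∀ {x y : ℚ}, padicNorm p x ≤ 1 → padicNorm p y ≤ 1 → padicNorm p (x - y) ≤ 1 :=
    fun hx hy => (padicNorm.sub (p := p)).trans (max_le hx hy)
  have hpow1 : ∀ {x : ℚ} (n : ℕ), padicNorm p x ≤ 1 → padicNorm p (x ^ n) ≤ 1 := by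
    intro x n hx; rw [padicNorm_pow_eq]; exact pow_le_one₀ (padicNorm.nonneg _) hx
  have hγ₃1 : padicNorm p γ₃ ≤ 1 := by
    rw [hγ₃, padicNorm.div, hsix, div_one]
    refine hadd1 (hsub1 (hpow1 3 hQ1) (hmul1 (hmul1 h3 hQ1) hQ₂1)) (hmul1 ?_ hQ₃1)
    simpa using padicNorm.of_nat (p := p) 2
  -- the two `ĝ`'s, `φ_x`, `φ₂,x`, `c_x`, `φ₃` over `S`
  have hcen : CentreIn b p q ↔ CentreIn b p x := centreIn_iff_of_mem hq
  have hgq : gHat b p q = 2 * A' * (if ¬ (2 : ℤ) ∣ b 0 ∧ ¬ CentreIn b p q then ((b 0 : ℤ) : ℚ) / 2 - q else 1) := by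
    rw [gHat, hA', hS, hqx]
  have hgx : gHat b p x = 2 * A * (if ¬ (2 : ℤ) ∣ b 0 ∧ ¬ CentreIn b p x then ((b 0 : ℤ) : ℚ) / 2 - x else 1) := rfl
  have hφx : phiHat b p x = Q + (if ¬ (2 : ℤ) ∣ b 0 ∧ ¬ CentreIn b p x then 1 / (((b 0 : ℤ) : ℚ) / 2 - x) else 0) := rfl
  have hφ2x : phi2Hat b p x = Q₂ + (if ¬ (2 : ℤ) ∣ b 0 ∧ ¬ CentreIn b p x then 1 / (((b 0 : ℤ) : ℚ) / 2 - x) ^ 2 else 0) := rfl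
  have hφ3x : phi3Expl b p x = Q₃ + (if ¬ (2 : ℤ) ∣ b 0 ∧ ¬ CentreIn b p x then 1 / (((b 0 : ℤ) : ℚ) / 2 - x) ^ 3 else 0) := rfl
  have hcx : curvHat b p x = ((Q + (if ¬ (2 : ℤ) ∣ b 0 ∧ ¬ CentreIn b p x then 1 / (((b 0 : ℤ) : ℚ) / 2 - x) else 0)) ^ 2
      - (Q₂ + (if ¬ (2 : ℤ) ∣ b 0 ∧ ¬ CentreIn b p x then 1 / (((b 0 : ℤ) : ℚ) / 2 - x) ^ 2 else 0))) / 2 := rfl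
  have hℓt : ((q / p : ℕ) : ℚ) * p = -t := by rw [htdef, neg_neg]
  rw [hgq, hgx, hcx, hφx, hφ2x, hφ3x, hℓt]
  by_cases h : ¬ (2 : ℤ) ∣ b 0 ∧ ¬ CentreIn b p q
  · -- odd `b₀`, centre outside the class: the centre factor is `c + t`, expanded exactly
    have h' : ¬ (2 : ℤ) ∣ b 0 ∧ ¬ CentreIn b p x := ⟨h.1, fun hc => h.2 (hcen.2 hc)⟩
    rw [if_pos h, if_pos h', if_pos h', if_pos h', if_pos h']
    set c : ℚ := ((b 0 : ℤ) : ℚ) / 2 - x with hc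
    have hc1 : padicNorm p c = 1 := padicNorm_centre_eq_one b hp2 h'.2
    have hc0 : c ≠ 0 := fun h0 => by rw [h0, padicNorm.zero] at hc1; exact zero_ne_one hc1
    have hc' : ((b 0 : ℤ) : ℚ) / 2 - q = c + t := by rw [hc, hqdec, htdef]; ring
    have hcq1 : padicNorm p (c + t) ≤ 1 := (padicNorm.nonarchimedean (p := p)).trans (max_le hc1.le ht1)
    rw [hc']
    have eI : 2 * A' * (c + t) - 2 * A * c * (1 - -t * (Q + 1 / c) + (-t) ^ 2 * (((Q + 1 / c) ^ 2 - (Q₂ + 1 / c ^ 2)) / 2)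
          - (-t) ^ 3 * (((Q + 1 / c) ^ 3 - 3 * (Q + 1 / c) * (Q₂ + 1 / c ^ 2) + 2 * (Q₃ + 1 / c ^ 3)) / 6)) =
        2 * (c + t) * (A' - A * (1 + t * Q + t ^ 2 * γ + t ^ 3 * γ₃)) + A * γ₃ * 2 * t ^ 4 := by
      rw [hγ, hγ₃]
      field_simp
      ring
    rw [eI]
    refine (padicNorm.nonarchimedean (p := p)).trans (max_le ?_ ?_)
    · rw [padicNorm.mul, padicNorm.mul, htwo, one_mul]
      calc padicNorm p (c + t) * _ ≤ 1 * (p : ℚ) ^ (-(4 : ℤ)) := mul_le_mul hcq1 hAQ (padicNorm.nonneg _) zero_le_one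
        _ = _ := one_mul _
    · exact padicNorm_mul_mul_pow_four_le (hmul1 hA1 hγ₃1) htwo.le ht
  · have h' : ¬ (¬ (2 : ℤ) ∣ b 0 ∧ ¬ CentreIn b p x) := fun hc => h ⟨hc.1, fun hcc => hc.2 (hcen.1 hcc)⟩
    rw [if_neg h, if_neg h', if_neg h', if_neg h', if_neg h']
    have eI : 2 * A' * 1 - 2 * A * 1 * (1 - -t * (Q + 0) + (-t) ^ 2 * (((Q + 0) ^ 2 - (Q₂ + 0)) / 2)
          - (-t) ^ 3 * (((Q + 0) ^ 3 - 3 * (Q + 0) * (Q₂ + 0) + 2 * (Q₃ + 0)) / 6)) =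
        2 * (A' - A * (1 + t * Q + t ^ 2 * γ + t ^ 3 * γ₃)) := by rw [hγ, hγ₃]; ring
    rw [eI, padicNorm.mul, htwo, one_mul]
    exact hAQ

end Summit.KontsevichZagierPeriods.Zeta5Search.SecondOrder

end
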